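import Summits.QuantumAdvantage.QuantumAdvantage.Theorems.LightDialC1

/-! # LightDialC2 — part C2 — offsets, the unrolled count, the ONE-MINORITY kernel law and its sign bit

NODE «LightDial» (decomp-qadv lens-2 g26) — the PREDECESSOR WITNESS `predW_b(x) = E_b + 2·E_b·O_b + 2·x_{b+1} (mod 3)` (`E_b/O_b` = number
of ones at the positions of the same / the other parity as `b`, even ring): an explicit rotation-covariant QUADRATIC strategy that is perfect on
every odd-class input of Hamming weight `≤ 5` at every even length — so `¬ LightFail 2 3` and `¬ LightFail 2 5` are THEOREMS (parts C3, C5) and the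
law-bet piece `LightFail 2 w → NoPerfectTwo3` of the dial (Theorems.LightDialA/B) is to be read at `w ≥ 7` (numerically the threshold is exactly 7:
g26 `num/Q-STRUCTURE.md`, critic 69v66). Five files C1 → … → C5 (gate form ≤ 400 lines each); rung 0, nothing here bears on 27432 itself.

THIS FILE: §12 (first half): `toff c j` (clockwise offset, no `%`), `cnt` (ones of parity `p` at offset `< t`), the UNROLLED-COUNT VECTOR `cntVec`, the
configuration `OneMinority x p c` (one minority one `c`, evenly many majority ones), ★ `OneMinority.inKernel_cntVec` (kernel law), `kvec_eq_cntVec`,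
and ★ `OneMinority.signBit_cntVec : signBit = (k/2) % 2` (edge count even by the `prv`-image pairing `edgesIn_cntVec`, `wtAnd_cntVec = k`).
-/

set_option linter.dupNamespace false
set_option linter.unnecessarySeqFocus false
noncomputable section
open scoped Classical

namespace Summit.QuantumAdvantage.QuantumAdvantage.Theorems.LightDial
open Finset
open Literature.Computability.QuantumComplexity Literature.Computability.QuantumComplexity.RingHLF
open Literature.Computability.MetaComplexity Literature.Computability.MetaComplexity.Smolensky
open Summit.QuantumAdvantage.AdviceFreeQNC0
open Summit.QuantumAdvantage.QuantumAdvantage.Theorems.RingPeriodFold (kvec kernel_pair_of_oddZeros kvec_ne_zero rel_iff_of_kernel_pair)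

variable {n : ℕ}

/-! ## §12 One minority one (splits `(2,1)`, `(4,1)`): the unrolled-count kernel vector -/

/-- closed form of the successor's value. -/
theorem nxt_val_eq (j : Fin n) : (nxt j).val = if j.val + 1 < n then j.val + 1 else 0 := by
  have hj := j.isLt
  show (j.val + 1) % n = _
  split_ifs with h
  · exact Nat.mod_eq_of_lt h
  · rw [show j.val + 1 = n by omega, Nat.mod_self]

/-- closed form of the predecessor's value. -/
theorem prv_val_eq (j : Fin n) : (prv j).val = if j.val = 0 then n - 1 else j.val - 1 := by
  have hj := j.isLt
  show (j.val + n - 1) % n = _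
  split_ifs with h
  · rw [h, Nat.zero_add]; exact Nat.mod_eq_of_lt (by omega)
  · rw [show j.val + n - 1 = (j.val - 1) + n by omega, Nat.add_mod_right]; exact Nat.mod_eq_of_lt (by omega)

/-- clockwise OFFSET of `j` from `c` (unrolling the ring at `c`; no `%`). -/
def toff (c j : Fin n) : ℕ := if c.val ≤ j.val then j.val - c.val else j.val + n - c.val

/-- offsets are `< n`. -/
theorem toff_lt (c j : Fin n) : toff c j < n := by
  unfold toff; have := j.isLt; have := c.isLt; split_ifs <;> omega

/-- the offset of `c` from itself is `0`. -/
@[simp] theorem toff_self (c : Fin n) : toff c c = 0 := by unfold toff; simp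

/-- offset `0` characterises `c`. -/
theorem toff_eq_zero_iff (c j : Fin n) : toff c j = 0 ↔ j = c := by
  constructor
  · intro h; unfold toff at h; have := j.isLt; have := c.isLt
    apply Fin.ext; split_ifs at h <;> omega
  · rintro rfl; exact toff_self _

/-- the offset from a fixed `c` is injective. -/
theorem toff_injective (c : Fin n) : Function.Injective (toff c) := by
  intro i j h; unfold toff at h; have := i.isLt; have := j.isLt; have := c.isLt
  apply Fin.ext; split_ifs at h <;> omega

/-- offset of the successor: `+1`, wrapping to `0`. -/
theorem toff_nxt (c j : Fin n) : toff c (nxt j) = if toff c j + 1 < n then toff c j + 1 else 0 := by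
  unfold toff; rw [nxt_val_eq]; have := j.isLt; have := c.isLt
  split_ifs <;> omega

/-- offset of the predecessor: `-1`, wrapping to `n-1`. -/
theorem toff_prv (c j : Fin n) : toff c (prv j) = if toff c j = 0 then n - 1 else toff c j - 1 := by
  unfold toff; rw [prv_val_eq]; have := j.isLt; have := c.isLt
  split_ifs <;> omega

/-- parity of the offset = sum of the parities (even ring). -/
theorem toff_mod_two (hn : Even n) (c j : Fin n) : toff c j % 2 = (par j + par c) % 2 := by
  obtain ⟨m, hm⟩ := hn
  unfold toff par; have := j.isLt; have := c.isLt
  split_ifs <;> omega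

/-- number of ones of parity `p` at offset `< t` from `c` (the unrolled count). -/
def cnt (x : Fin n → Bool) (p : ℕ) (c : Fin n) (t : ℕ) : ℕ :=
  (univ.filter fun i : Fin n => x i = true ∧ par i = p ∧ toff c i < t).card

/-- nothing lies at offset `< 0`. -/
theorem cnt_zero (x : Fin n → Bool) (p : ℕ) (c : Fin n) : cnt x p c 0 = 0 := by
  unfold cnt; rw [Finset.card_eq_zero, Finset.filter_eq_empty_iff]; intro i _ h; omega

/-- beyond the ring the count is the number of ones of parity `p`. -/
theorem cnt_of_ge (x : Fin n → Bool) (p : ℕ) (c : Fin n) {t : ℕ} (ht : n ≤ t) :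
    cnt x p c t = (univ.filter fun i : Fin n => x i = true ∧ par i = p).card := by
  unfold cnt; congr 1; ext i; simp only [mem_filter, mem_univ, true_and]
  have := toff_lt c i
  constructor
  · rintro ⟨h1, h2, _⟩; exact ⟨h1, h2⟩
  · rintro ⟨h1, h2⟩; exact ⟨h1, h2, by omega⟩

/-- one step of the count: passing offset `t` adds the one sitting there (if it has parity `p`). -/
theorem cnt_succ (x : Fin n → Bool) (p : ℕ) (c : Fin n) (t : ℕ) :
    cnt x p c (t + 1) = cnt x p c t + (univ.filter fun i : Fin n => x i = true ∧ par i = p ∧ toff c i = t).card := by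
  unfold cnt
  rw [← Finset.card_union_of_disjoint]
  · congr 1; ext i; simp only [mem_filter, mem_univ, true_and, mem_union]
    constructor
    · rintro ⟨h1, h2, h3⟩
      by_cases h : toff c i < t
      · exact Or.inl ⟨h1, h2, h⟩
      · exact Or.inr ⟨h1, h2, by omega⟩
    · rintro (⟨h1, h2, h3⟩ | ⟨h1, h2, h3⟩)
      · exact ⟨h1, h2, by omega⟩
      · exact ⟨h1, h2, by omega⟩
  · rw [Finset.disjoint_filter]; intro i _ h1 h2; omega

/-- the position at offset `t`: if it does not have parity `p` (or carries no one) the step adds nothing … -/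
theorem card_at_eq_zero {x : Fin n → Bool} {p : ℕ} {c : Fin n} {t : ℕ}
    (h : ∀ i : Fin n, toff c i = t → ¬ (x i = true ∧ par i = p)) :
    (univ.filter fun i : Fin n => x i = true ∧ par i = p ∧ toff c i = t).card = 0 := by
  rw [Finset.card_eq_zero, Finset.filter_eq_empty_iff]
  rintro i _ ⟨h1, h2, h3⟩; exact h i h3 ⟨h1, h2⟩

/-- … and if it is `b` (parity `p`) the step adds `[x b]`. -/
theorem card_at_eq {x : Fin n → Bool} {p : ℕ} {c b : Fin n} (hb : par b = p) :
    (univ.filter fun i : Fin n => x i = true ∧ par i = p ∧ toff c i = toff c b).card = if x b = true then 1 else 0 := by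
  have hset : (univ.filter fun i : Fin n => x i = true ∧ par i = p ∧ toff c i = toff c b) =
      if x b = true then {b} else ∅ := by
    ext i; simp only [mem_filter, mem_univ, true_and]
    constructor
    · rintro ⟨h1, _, h3⟩
      have hi : i = b := toff_injective c h3
      subst hi; rw [if_pos h1]; exact mem_singleton_self _
    · intro h
      split_ifs at h with hx
      · rw [mem_singleton] at h; subst h; exact ⟨hx, hb, rfl⟩
      · exact absurd h (Finset.notMem_empty _)
  rw [hset]; split_ifs <;> simp

/-- ★ the UNROLLED-COUNT VECTOR of an input with majority parity `p` unrolled at `c`: all of the class `p`, and a position of the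
other class iff an ODD number of parity-`p` ones precede it clockwise from `c`. -/
def cntVec (x : Fin n → Bool) (p : ℕ) (c : Fin n) : Fin n → Bool :=
  fun j => if par j = p then true else decide (cnt x p c (toff c j) % 2 = 1)

/-- hypotheses of the one-minority configuration: even ring, `c` is a one, every OTHER one has parity `p ≠ par c` (`p < 2`), and the
number `k` of parity-`p` ones is even (automatic on the odd class). -/
structure OneMinority (x : Fin n → Bool) (p : ℕ) (c : Fin n) : Prop where
  /-- the ring length is even -/
  even : Even n
  /-- and at least `3` -/
  three : 3 ≤ n
  /-- `c` is a one -/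
  hc : x c = true
  /-- `c` has minority parity -/
  hpc : par c ≠ p
  /-- every other one has parity `p` -/
  hmaj : ∀ j, x j = true → j ≠ c → par j = p
  /-- `p` is a parity -/
  hp2 : p < 2
  /-- the number of majority ones is even -/
  hk : Even (univ.filter fun i : Fin n => x i = true ∧ par i = p).card

namespace OneMinority
variable {x : Fin n → Bool} {p : ℕ} {c : Fin n}

/-- the class-`p` successor of `c` shows the vector is nonzero. -/
theorem par_nxt_c (h : OneMinority x p c) : par (nxt c) = p := by
  have h1 := par_nxt h.even c; have h2 := par_lt_two c; have h3 := h.hpc; have h4 := h.hp2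
  unfold par at *; omega

/-- the unrolled-count vector is nonzero (it contains the class-`p` successor of `c`). -/
theorem cntVec_ne_zero (h : OneMinority x p c) : cntVec x p c ≠ fun _ => false := by
  intro h0; have := congrFun h0 (nxt c); simp [cntVec, h.par_nxt_c] at this

/-- a one of parity `≠ p` is `c`. -/
theorem eq_c_of_one (h : OneMinority x p c) {j : Fin n} (hj : x j = true) (hpj : par j ≠ p) : j = c := by
  by_contra hne; exact hpj (h.hmaj j hj hne)

/-- ★ KERNEL LAW (one minority one): the unrolled-count vector is a kernel vector. -/
theorem inKernel_cntVec (h : OneMinority x p c) : InKernel x (cntVec x p c) := by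
  intro b
  have hpn := par_nxt h.even b; have hpp := par_prv h.even b; have hb2 := par_lt_two b; have hp2 := h.hp2
  by_cases hb : par b = p
  · -- majority-parity position: neighbours are read off the unrolled count
    have hn' : par (nxt b) ≠ p := by unfold par at *; omega
    have hp' : par (prv b) ≠ p := by unfold par at *; omega
    have hbc : b ≠ c := fun e => h.hpc (e ▸ hb)
    have ht0 : toff c b ≠ 0 := fun e => hbc ((toff_eq_zero_iff c b).mp e)
    have hVb : cntVec x p c b = true := by simp [cntVec, hb]
    have hVn : cntVec x p c (nxt b) = decide (cnt x p c (toff c (nxt b)) % 2 = 1) := by simp [cntVec, hn']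
    have hVp : cntVec x p c (prv b) = decide (cnt x p c (toff c (prv b)) % 2 = 1) := by simp [cntVec, hp']
    rw [hVb, hVn, hVp, toff_prv, if_neg ht0, Bool.and_true]
    -- the count two steps on differs by `[x b]` (the position between has the wrong parity)
    have hstep : cnt x p c (toff c b + 1) = cnt x p c (toff c b - 1) + (if x b = true then 1 else 0) := by
      have e1 : toff c b = (toff c b - 1) + 1 := by omega
      rw [cnt_succ, card_at_eq hb]
      conv_lhs => rw [e1, cnt_succ]
      rw [card_at_eq_zero, Nat.add_zero]
      intro i hi ⟨_, hip⟩
      have m1 := toff_mod_two h.even c i; have m2 := toff_mod_two h.even c b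
      unfold par at *; omega
    by_cases hlast : toff c b + 1 < n
    · rw [toff_nxt, if_pos hlast, hstep]
      cases x b <;> simp <;> omega
    · -- wrap-around at `b = prv c`: uses that the number of parity-`p` ones is even
      have hT : toff c b = n - 1 := by have := toff_lt c b; omega
      rw [toff_nxt, if_neg hlast, cnt_zero]
      have hfull : cnt x p c (toff c b + 1) = (univ.filter fun i : Fin n => x i = true ∧ par i = p).card :=
        cnt_of_ge x p c (by omega)
      obtain ⟨m, hm⟩ := h.hk
      rw [hstep] at hfull
      cases hxb : x b <;> simp [hxb] at hfull ⊢ <;> omega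
  · -- minority-parity position: both neighbours lie in the class `p`; the position itself is `c` if it is a one
    have hn' : par (nxt b) = p := by unfold par at *; omega
    have hp' : par (prv b) = p := by unfold par at *; omega
    have hVn : cntVec x p c (nxt b) = true := by simp [cntVec, hn']
    have hVp : cntVec x p c (prv b) = true := by simp [cntVec, hp']
    rw [hVn, hVp]
    cases hxb : x b
    · simp
    · have hbc : b = c := h.eq_c_of_one hxb hb
      subst hbc
      simp [cntVec, hb, cnt_zero]

/-- hence it IS the canonical kernel vector (odd class). -/
theorem kvec_eq_cntVec (h : OneMinority x p c) (hx : OddZeros x) : kvec x = cntVec x p c := by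
  rcases (kernel_pair_of_oddZeros h.three hx _).mp h.inKernel_cntVec with e | e
  · exact absurd e h.cntVec_ne_zero
  · exact e.symm

/-! ### sign bit of the unrolled-count vector: `(k/2) mod 2` -/

/-- the unrolled count at `c` itself is empty, so the vector skips the minority one … -/
theorem cntVec_c (h : OneMinority x p c) : cntVec x p c c = false := by
  simp [cntVec, h.hpc, cnt_zero]

/-- … and contains every majority one: the ones it meets are exactly the parity-`p` ones. -/
theorem wtAnd_cntVec (h : OneMinority x p c) :
    wtAnd x (cntVec x p c) = (univ.filter fun i : Fin n => x i = true ∧ par i = p).card := by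
  unfold wtAnd; congr 1; ext i; simp only [mem_filter, mem_univ, true_and]
  constructor
  · rintro ⟨hi, hV⟩
    refine ⟨hi, ?_⟩
    by_contra hpi
    have hic := h.eq_c_of_one hi hpi; subst hic
    rw [h.cntVec_c] at hV; exact Bool.false_ne_true hV
  · rintro ⟨hi, hpi⟩; exact ⟨hi, by simp [cntVec, hpi]⟩

/-- the minority-parity support of the vector. -/
def mset (x : Fin n → Bool) (p : ℕ) (c : Fin n) : Finset (Fin n) :=
  univ.filter fun j : Fin n => par j ≠ p ∧ cntVec x p c j = true

/-- ring edges inside the vector come in pairs around each minority-parity member: the edge count is even. -/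
theorem edgesIn_cntVec (h : OneMinority x p c) : edgesIn (cntVec x p c) = 2 * (mset x p c).card := by
  have hp2 := h.hp2
  unfold edgesIn
  set E := univ.filter fun b : Fin n => cntVec x p c b = true ∧ cntVec x p c (nxt b) = true with hE
  have hsplit := Finset.card_filter_add_card_filter_not (s := E) (fun b : Fin n => par b = p)
  -- edges starting at a majority-parity position ↔ their end lies in `mset`
  have h1 : E.filter (fun b : Fin n => par b = p) = (mset x p c).image prv := by
    ext b; simp only [hE, mset, mem_filter, mem_univ, true_and, mem_image]
    have hpn := par_nxt h.even b; have hb2 := par_lt_two b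
    constructor
    · rintro ⟨⟨_, hVn⟩, hb⟩
      refine ⟨nxt b, ⟨?_, hVn⟩, prv_nxt b⟩
      unfold par at *; omega
    · rintro ⟨j, ⟨hj, hVj⟩, rfl⟩
      have hpp := par_prv h.even j; have hj2 := par_lt_two j
      have hb : par (prv j) = p := by unfold par at *; omega
      refine ⟨⟨by simp [cntVec, hb], ?_⟩, hb⟩
      rw [nxt_prv]; exact hVj
  -- edges starting at a minority-parity position ↔ the start lies in `mset`
  have h2 : E.filter (fun b : Fin n => ¬ par b = p) = mset x p c := by
    ext b; simp only [hE, mset, mem_filter, mem_univ, true_and]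
    have hpn := par_nxt h.even b; have hb2 := par_lt_two b
    constructor
    · rintro ⟨⟨hVb, _⟩, hb⟩; exact ⟨hb, hVb⟩
    · rintro ⟨hb, hVb⟩
      have hn' : par (nxt b) = p := by unfold par at *; omega
      exact ⟨⟨hVb, by simp [cntVec, hn']⟩, hb⟩
  rw [h1, h2, Finset.card_image_of_injective _ prv_injective] at hsplit
  omega

/-- ★ SIGN LAW (one minority one): the sign bit of the kernel vector is `(k/2) mod 2`, `k` = number of majority ones
(`(2,1)`: `1`; `(4,1)`: `0`). -/
theorem signBit_cntVec (h : OneMinority x p c) :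
    signBit x (cntVec x p c) = ((univ.filter fun i : Fin n => x i = true ∧ par i = p).card / 2) % 2 := by
  unfold signBit; rw [h.edgesIn_cntVec, h.wtAnd_cntVec]; omega

end OneMinority

end Summit.QuantumAdvantage.QuantumAdvantage.Theorems.LightDial
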